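import Mathlib.NumberTheory.LegendreSymbol.QuadraticChar.Basic
import Literature.NumberTheory.GaloisRepresentations.SerreCartanNormalizerGL2Fp
import Literature.NumberTheory.GaloisRepresentations.SerreSubgroupsGL2Fp
import HarnessLib

/-!
# Odd irreducible subgroups of `GL₂(𝔽_p)` meeting `SL₂(𝔽_p)` absolutely reducibly normalise a
# Cartan subgroup (Freitas–Le Hung–Siksek 2015, Lemma 3.2; proofs)

Topic `Literature/NumberTheory/GaloisRepresentations`; a *proofs* file (theorems only, Mathlib and
the tree's Serre 1972 §2 vocabulary `Serre1972.adjoinElem`, `unitGroup`, `splitCartan`,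
`cartanSubgroups`). N. Freitas, B. V. Le Hung, S. Siksek, *Elliptic curves over real quadratic
fields are modular*, Invent. Math. 201 (2015) [FreitasLeHungSiksek2015], §2.3 (p. 10 of the held
text `paper:arxiv-1310.7088`):

> **Lemma 3.2.** Let `p ≥ 3` be prime. Let `G` be an absolutely irreducible subgroup of
> `GL₂(𝔽_p)` such that `G ∩ SL₂(𝔽_p)` is absolutely reducible. Then `G` is contained in the
> normalizer of a Cartan subgroup. If moreover `det(G) = 𝔽_p^*`, then `G ∩ GL₂⁺(𝔽_p)` is
> contained in a Cartan subgroup, where `GL₂⁺(𝔽_p)` is the subgroup of `GL₂(𝔽_p)` consisting of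
> matrices with square determinant.

Its only use in the source is the proof of Prop. 1.1 (§4.1), for subgroups `G` which are
moreover **odd** ("there is some element `c ∈ G` with eigenvalues `1` and `-1`"). Under that
extra hypothesis the lemma has a short proof avoiding Dickson's classification of the subgroups
of `PGL₂(𝔽_p)` (Swinnerton-Dyer's list (a)–(e) quoted by the source), and this is what is proved
here, with all hypotheses on the level of vectors and matrices:

* `exists_le_normalizer_unitGroup_adjoinElem` — for `p ≠ 2` and `G ≤ GL₂(𝔽_p)` with (i) no
  `G`-stable line in `𝔽_p²` and a common eigenvector, after a base change `f : 𝔽_p → B`, of all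
  `g ∈ G` with `det g = 1`; (ii) an involution `c ∈ G` with `det c = -1`; (iii) `det` onto
  `𝔽_pˣ`: there is a regular semisimple non-scalar `g₀ ∈ G ∩ SL₂(𝔽_p)` such that `G` normalises
  the Cartan subgroup `C = 𝔽_p[g₀]ˣ` and `G ∩ C = {g ∈ G | det g square}`.

Steps (each a theorem): `not_dvd_card_of_irreducible_of_eigenvector` (`p ∤ |G|`, by Serre's
Prop. 15 `Serre1972.ker_det_le_or_exists_eigenvector_of_dvd_card` and the two transvections);
`exists_det_eq_one_ne_smul_one` (a non-scalar element of determinant one: else `G` is abelian —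
cyclic quotient by a central kernel — and commutes with `c`, so lies in the split Cartan subgroup
`𝔽_p[c]ˣ` and fixes a line); `disc_ne_zero_of_not_dvd_card`; `mul_comm_of_det_eq_one`
(`G ∩ SL₂` is abelian: a commutator fixing the common eigenvector is unipotent, of order `1` or
`p`); then `G ∩ SL₂ ⊆ 𝔽_p[g₀]ˣ`, `G ⊆ N(𝔽_p[g₀]ˣ)` (`Serre1972.le_normalizer_unitGroup_adjoinElem`),
`G ⊄ C` (irreducibility / `c ≠ ±1` in the field `𝔽_p[g₀]`), and the description of `G ∩ C` via
`Serre1972.sq_eq_smul_one_of_mem_normalizer` and the quadratic character.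

For representations: (i) is "`ρ` irreducible and `ρ|_{Γ_{K(ζ_p)}}` not absolutely irreducible"
once `det ρ = χ̄_p` (`CyclotomicDeterminantImageProofs.lean`), (ii) is a complex conjugation, (iii)
is the surjectivity of `χ̄_p` (`ModPCyclotomicCharacterTotallyRealProofs.lean`). The case
distinctions of Prop. 1.1 for `p = 3, 5, 7` are made elsewhere from this theorem.

## References

* [FreitasLeHungSiksek2015] Invent. Math. 201 (2015) 159–206, §2.3 Lemma 3.2 and §4.1 Prop. 1.1
  (proof) — held `paper:arxiv-1310.7088`, pp. 10 and 19 of the text.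
* [Serre1972] J.-P. Serre, Invent. Math. 15 (1972), §2.1–2.4 (Cartan subgroups, Prop. 15) — the
  tree files `SerreCartanSubgroupsGL2Fp{,Proofs}`, `SerreCartanNormalizerGL2Fp`,
  `SerreSubgroupsGL2Fp`.
-/

open Matrix
open scoped MatrixGroups

namespace Literature.NumberTheory.GaloisRepresentations.FLS2015

variable {p : ℕ} [Fact p.Prime]

section Subgroup

variable {G : Subgroup (GL (Fin 2) (ZMod p))}

/-! ### (i) forces `p ∤ |G|` -/

/-- The two elementary transvections have no common eigenvector after any base change
`f : 𝔽_p → B`: if `f(1 1; 0 1) v ∈ B v` and `f(1 0; 1 1) v ∈ B v` then `v = 0`. [folklore] -/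
theorem eq_zero_of_transvections_eigenvector {B : Type*} [Field B] (f : ZMod p →+* B)
    {v : Fin 2 → B} {a b : B}
    (ha : ((!![1, 1; 0, 1] : Matrix (Fin 2) (Fin 2) (ZMod p)).map f) *ᵥ v = a • v)
    (hb : ((!![1, 0; 1, 1] : Matrix (Fin 2) (Fin 2) (ZMod p)).map f) *ᵥ v = b • v) : v = 0 := by
  have ha0 := congr_fun ha 0
  have ha1 := congr_fun ha 1
  have hb0 := congr_fun hb 0
  have hb1 := congr_fun hb 1
  simp only [Matrix.mulVec, dotProduct, Fin.sum_univ_two, Matrix.map_apply, Matrix.of_apply,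
    Matrix.cons_val', Matrix.cons_val_zero, Matrix.cons_val_one, Matrix.cons_val_fin_one,
    Matrix.empty_val', map_one, map_zero, one_mul, zero_mul, add_zero, zero_add,
    Pi.smul_apply, smul_eq_mul] at ha0 ha1 hb0 hb1
  -- `ha0 : v 0 + v 1 = a * v 0`, `ha1 : v 1 = a * v 1`, `hb0 : v 0 = b * v 0`,
  -- `hb1 : v 0 + v 1 = b * v 1`
  have h1 : v 1 = 0 := by
    by_contra h
    have : a = 1 := by
      have := mul_right_cancel₀ h (show a * v 1 = 1 * v 1 by rw [one_mul, ← ha1])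
      exact this
    rw [this, one_mul] at ha0
    exact h (by linear_combination ha0)
  have h0 : v 0 = 0 := by
    rw [h1, add_zero] at hb1
    rw [hb1, mul_zero]
  funext i
  fin_cases i
  · exact h0
  · exact h1

/-- **`p ∤ |G|`** for a subgroup `G ≤ GL₂(𝔽_p)` which is irreducible (no `G`-stable line in
`𝔽_p²`) and whose determinant-one part `G ∩ SL₂(𝔽_p)` has a common eigenvector after some base
change `f : 𝔽_p → B` (is absolutely reducible): otherwise, by Serre's Prop. 15
(`Serre1972.ker_det_le_or_exists_eigenvector_of_dvd_card`), `G` would either stabilise a line or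
contain `SL₂(𝔽_p)`, whose transvections have no common eigenvector
(`eq_zero_of_transvections_eigenvector`). This is the first paragraph of the proof of
Freitas–Le Hung–Siksek 2015, Lemma 3.2. [cite: FreitasLeHungSiksek2015, Lemma 3.2 (proof)] -/
theorem not_dvd_card_of_irreducible_of_eigenvector
    (hirr : ∀ v : Fin 2 → ZMod p, v ≠ 0 → ∃ g ∈ G, ∀ a : ZMod p, (g : Matrix (Fin 2) (Fin 2) (ZMod p)) *ᵥ v ≠ a • v)
    {B : Type*} [Field B] (f : ZMod p →+* B) {v : Fin 2 → B} (hv : v ≠ 0)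
    (hB : ∀ g ∈ G, GeneralLinearGroup.det g = 1 → ∃ a : B, ((g : Matrix (Fin 2) (Fin 2) (ZMod p)).map f) *ᵥ v = a • v) :
    ¬ p ∣ Nat.card G := by
  intro hdvd
  rcases Serre1972.ker_det_le_or_exists_eigenvector_of_dvd_card G hdvd with hker | ⟨w, hw, hG⟩
  · set u : GL (Fin 2) (ZMod p) :=
      GeneralLinearGroup.mkOfDetNeZero !![1, 1; 0, 1] (by simp [Matrix.det_fin_two_of]) with hu
    set l : GL (Fin 2) (ZMod p) :=
      GeneralLinearGroup.mkOfDetNeZero !![1, 0; 1, 1] (by simp [Matrix.det_fin_two_of]) with hl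
    have hu1 : GeneralLinearGroup.det u = 1 :=
      Units.ext (by simp [hu, GeneralLinearGroup.val_det_apply, Matrix.det_fin_two_of])
    have hl1 : GeneralLinearGroup.det l = 1 :=
      Units.ext (by simp [hl, GeneralLinearGroup.val_det_apply, Matrix.det_fin_two_of])
    obtain ⟨a, ha⟩ := hB u (hker hu1) hu1
    obtain ⟨b, hb⟩ := hB l (hker hl1) hl1
    exact hv (eq_zero_of_transvections_eigenvector f ha hb)
  · obtain ⟨g, hg, hne⟩ := hirr w hw
    obtain ⟨c, hc⟩ := hG g hg
    exact hne c hc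

/-! ### Columns of invertible matrices -/

/-- The columns of an invertible matrix are non-zero. [folklore] -/
theorem col_ne_zero (Q : GL (Fin 2) (ZMod p)) (j : Fin 2) : (Q : Matrix (Fin 2) (Fin 2) (ZMod p)).col j ≠ 0 := by
  intro h
  apply GL2.det_ne_zero Q
  exact Matrix.det_eq_zero_of_column_eq_zero j fun i ↦ congr_fun h i

/-! ### Involutions of determinant `-1` -/

/-- The matrix of an element of `GL₂` with `det = -1` has determinant `-1`. [folklore] -/
theorem det_coe_eq_neg_one {c : GL (Fin 2) (ZMod p)} (hcdet : GeneralLinearGroup.det c = -1) :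
    (c : Matrix (Fin 2) (Fin 2) (ZMod p)).det = -1 := by
  have h := congrArg (fun u : (ZMod p)ˣ ↦ (u : ZMod p)) hcdet
  simpa only [GeneralLinearGroup.val_det_apply, Units.val_neg, Units.val_one] using h

/-- An involution of determinant `-1` is non-scalar (`p ≠ 2`). [folklore] -/
theorem ne_smul_one_of_mul_self_eq_one (hp2 : p ≠ 2) {c : GL (Fin 2) (ZMod p)}
    (hcc : c * c = 1) (hcdet : GeneralLinearGroup.det c = -1) (s : ZMod p) :
    (c : Matrix (Fin 2) (Fin 2) (ZMod p)) ≠ s • 1 := by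
  intro hs
  have hdetc := det_coe_eq_neg_one hcdet
  have hcc' : (c : Matrix (Fin 2) (Fin 2) (ZMod p)) * (c : Matrix (Fin 2) (Fin 2) (ZMod p)) = 1 := by rw [← Units.val_mul, hcc, Units.val_one]
  have h1 : s * s = 1 := by
    have := congr_fun (congr_fun hcc' 0) 0
    simpa [hs, Matrix.mul_apply, Fin.sum_univ_two] using this
  have h2 : s * s = -1 := by
    rw [hs, Matrix.det_smul, Matrix.det_one, mul_one, Fintype.card_fin] at hdetc
    rw [← hdetc]; ring
  exact (Ring.two_ne_zero (by rw [ZMod.ringChar_zmod_n]; exact hp2)) (by linear_combination h2 - h1)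

/-- An involution of determinant `-1` has trace `0` (Cayley–Hamilton; `p ≠ 2`). [folklore] -/
theorem trace_eq_zero_of_mul_self_eq_one (hp2 : p ≠ 2) {c : GL (Fin 2) (ZMod p)}
    (hcc : c * c = 1) (hcdet : GeneralLinearGroup.det c = -1) : (c : Matrix (Fin 2) (Fin 2) (ZMod p)).trace = 0 := by
  have hdetc := det_coe_eq_neg_one hcdet
  have hcc' : (c : Matrix (Fin 2) (Fin 2) (ZMod p)) * (c : Matrix (Fin 2) (Fin 2) (ZMod p)) = 1 := by rw [← Units.val_mul, hcc, Units.val_one]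
  have hCH := DeligneSerre1974.TwoByTwo.mul_self_eq (c : Matrix (Fin 2) (Fin 2) (ZMod p))
  rw [hcc', hdetc, neg_smul, one_smul, sub_neg_eq_add] at hCH
  have h0 : (c : Matrix (Fin 2) (Fin 2) (ZMod p)).trace • (c : Matrix (Fin 2) (Fin 2) (ZMod p)) = 0 := by
    have := hCH.symm
    rwa [add_eq_right] at this
  by_contra ht
  apply ne_smul_one_of_mul_self_eq_one hp2 hcc hcdet 0
  rw [zero_smul]
  have := congrArg ((c : Matrix (Fin 2) (Fin 2) (ZMod p)).trace⁻¹ • ·) h0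
  simpa only [smul_smul, inv_mul_cancel₀ ht, one_smul, smul_zero] using this

/-- For an involution `c` of determinant `-1`, `𝔽_p[c]ˣ` is a split Cartan subgroup (`c` has
the eigenvalue `1` and discriminant `4 ≠ 0`). [folklore] -/
theorem exists_unitGroup_adjoinElem_eq_splitCartan_of_mul_self_eq_one (hp2 : p ≠ 2)
    {c : GL (Fin 2) (ZMod p)} (hcc : c * c = 1) (hcdet : GeneralLinearGroup.det c = -1) :
    ∃ Q : GL (Fin 2) (ZMod p),
      Serre1972.unitGroup (Serre1972.adjoinElem (c : Matrix (Fin 2) (Fin 2) (ZMod p))) = Serre1972.splitCartan Q := by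
  have hdetc := det_coe_eq_neg_one hcdet
  have htrc := trace_eq_zero_of_mul_self_eq_one hp2 hcc hcdet
  have hdisc : (c : Matrix (Fin 2) (Fin 2) (ZMod p)).trace ^ 2 - 4 * (c : Matrix (Fin 2) (Fin 2) (ZMod p)).det ≠ 0 := by
    rw [htrc, hdetc, show (0 : ZMod p) ^ 2 - 4 * -1 = 2 ^ 2 by ring]
    exact pow_ne_zero 2 ((Ring.two_ne_zero (by rw [ZMod.ringChar_zmod_n]; exact hp2)))
  have hroot : (1 : ZMod p) ^ 2 - (c : Matrix (Fin 2) (Fin 2) (ZMod p)).trace * 1 + (c : Matrix (Fin 2) (Fin 2) (ZMod p)).det = 0 := by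
    rw [htrc, hdetc]; ring
  exact Serre1972.exists_unitGroup_adjoinElem_eq_splitCartan hdisc hroot

/-! ### A non-scalar element of determinant one -/

/-- **A non-scalar element of determinant one.** If `G` is irreducible and contains an
involution `c` of determinant `-1` (`p ≠ 2`), then `G ∩ SL₂(𝔽_p)` contains a non-scalar
element: otherwise the kernel of `det : G → 𝔽_pˣ` is central and the quotient cyclic, so `G` is
abelian (`commutative_of_cyclic_center_quotient`); then `G` commutes with `c`, hence is diagonal
in an eigenbasis of `c` (`GL2.exists_conj_eq_diagonal`, `GL2.isDg_of_commute_diagonal`) and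
stabilises a line — second paragraph of the proof of Freitas–Le Hung–Siksek 2015, Lemma 3.2
("If `G'` consists only of scalar matrices, then `H` … is cyclic"), with oddness in place of
Dickson's list. [cite: FreitasLeHungSiksek2015, Lemma 3.2 (proof)] -/
theorem exists_det_eq_one_ne_smul_one (hp2 : p ≠ 2)
    (hirr : ∀ v : Fin 2 → ZMod p, v ≠ 0 → ∃ g ∈ G, ∀ a : ZMod p, (g : Matrix (Fin 2) (Fin 2) (ZMod p)) *ᵥ v ≠ a • v)
    {c : GL (Fin 2) (ZMod p)} (hcG : c ∈ G) (hcc : c * c = 1)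
    (hcdet : GeneralLinearGroup.det c = -1) :
    ∃ g ∈ G, GeneralLinearGroup.det g = 1 ∧ ∀ s : ZMod p, (g : Matrix (Fin 2) (Fin 2) (ZMod p)) ≠ s • 1 := by
  by_contra hall
  push Not at hall
  -- `G` is abelian
  have hcomm : ∀ a b : G, a * b = b * a := by
    set f : G →* (ZMod p)ˣ := (GeneralLinearGroup.det).comp G.subtype with hf
    have hker : f.ker ≤ Subgroup.center G := by
      intro x hx
      rw [MonoidHom.mem_ker] at hx
      obtain ⟨s, hs⟩ := hall x x.2 hx
      exact DeligneSerre1974.mem_center_of_mat_eq x hs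
    exact (f.isMulCommutative_of_isCyclic_of_ker_le_center hker).is_comm.comm
  -- `𝔽_p[c]ˣ` is a split Cartan subgroup
  have hcs := ne_smul_one_of_mul_self_eq_one hp2 hcc hcdet
  obtain ⟨Q, hQ⟩ := exists_unitGroup_adjoinElem_eq_splitCartan_of_mul_self_eq_one hp2 hcc hcdet
  -- every element of the abelian group `G ∋ c` lies in `𝔽_p[c]ˣ = splitCartan Q`
  have hle : G ≤ Serre1972.unitGroup (Serre1972.adjoinElem (c : Matrix (Fin 2) (Fin 2) (ZMod p))) :=
    Serre1972.le_unitGroup_adjoinElem_of_comm hcomm (y := ⟨c, hcG⟩) hcs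
  -- so the first column of `Q` is a common eigenvector
  obtain ⟨g, hg, hne⟩ := hirr ((Q : Matrix (Fin 2) (Fin 2) (ZMod p)).col 0) (col_ne_zero Q 0)
  obtain ⟨⟨a, ha⟩, -⟩ := Serre1972.mem_splitCartan_iff_col.mp (hQ ▸ hle hg)
  exact hne a ha

/-- Such an element is **regular semisimple** (`tr² - 4 det ≠ 0`) as soon as `p ∤ |G|`
(`DeligneSerre1974.TwoByTwo.disc_ne_zero_of_pow_eq_one`: a non-scalar matrix with a repeated
eigenvalue has order divisible by `p`). [folklore] -/
theorem disc_ne_zero_of_not_dvd_card (hp2 : p ≠ 2) (hp : ¬ p ∣ Nat.card G)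
    {g : GL (Fin 2) (ZMod p)} (hg : g ∈ G) (hgs : ∀ s : ZMod p, (g : Matrix (Fin 2) (Fin 2) (ZMod p)) ≠ s • 1) :
    (g : Matrix (Fin 2) (Fin 2) (ZMod p)).trace ^ 2 - 4 * (g : Matrix (Fin 2) (Fin 2) (ZMod p)).det ≠ 0 := by
  haveI : Finite G := Nat.finite_of_card_ne_zero (fun h ↦ hp (h ▸ dvd_zero p))
  have horder : orderOf g ∣ Nat.card G := by
    rw [← Subgroup.orderOf_mk g hg]
    exact orderOf_dvd_natCard _
  have hm : ((orderOf g : ℕ) : ZMod p) ≠ 0 := by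
    intro h
    exact hp ((ZMod.natCast_eq_zero_iff _ p).mp h |>.trans horder)
  refine DeligneSerre1974.TwoByTwo.disc_ne_zero_of_pow_eq_one ((Ring.two_ne_zero (by rw [ZMod.ringChar_zmod_n]; exact hp2))) hgs
    (GL2.det_ne_zero g) hm ?_
  rw [← Units.val_pow_eq_pow_val, pow_orderOf_eq_one, Units.val_one]

/-! ### The determinant-one part is abelian -/

/-- If `f(g) v = a v` with `g` invertible and `v ≠ 0`, then `a ≠ 0` and `f(g⁻¹) v = a⁻¹ v`.
[folklore] -/
theorem map_inv_mulVec_eq {B : Type*} [Field B] (f : ZMod p →+* B) {v : Fin 2 → B} (hv : v ≠ 0)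
    {g : GL (Fin 2) (ZMod p)} {a : B} (ha : ((g : Matrix (Fin 2) (Fin 2) (ZMod p)).map f) *ᵥ v = a • v) :
    a ≠ 0 ∧ (((g⁻¹ : GL (Fin 2) (ZMod p)) : Matrix (Fin 2) (Fin 2) (ZMod p)).map f) *ᵥ v = a⁻¹ • v := by
  have hinv : ((g⁻¹ : GL (Fin 2) (ZMod p)) : Matrix (Fin 2) (Fin 2) (ZMod p)).map f * (g : Matrix (Fin 2) (Fin 2) (ZMod p)).map f = 1 := by
    rw [← Matrix.map_mul, ← Units.val_mul, inv_mul_cancel, Units.val_one,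
      Matrix.map_one _ (map_zero f) (map_one f)]
  have key : (((g⁻¹ : GL (Fin 2) (ZMod p)) : Matrix (Fin 2) (Fin 2) (ZMod p)).map f) *ᵥ (a • v) = v := by
    rw [← ha, Matrix.mulVec_mulVec, hinv, Matrix.one_mulVec]
  have ha0 : a ≠ 0 := by
    rintro rfl
    rw [zero_smul, Matrix.mulVec_zero] at key
    exact hv key.symm
  refine ⟨ha0, ?_⟩
  rw [Matrix.mulVec_smul] at key
  calc (((g⁻¹ : GL (Fin 2) (ZMod p)) : Matrix (Fin 2) (Fin 2) (ZMod p)).map f) *ᵥ v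
        = a⁻¹ • (a • ((((g⁻¹ : GL (Fin 2) (ZMod p)) : Matrix (Fin 2) (Fin 2) (ZMod p)).map f) *ᵥ v)) := by
          rw [smul_smul, inv_mul_cancel₀ ha0, one_smul]
    _ = a⁻¹ • v := by rw [key]

/-- **`G ∩ SL₂(𝔽_p)` is abelian** when `p ∤ |G|` and `G ∩ SL₂(𝔽_p)` has a common eigenvector `v`
after a base change `f`: a commutator `q = a b a⁻¹ b⁻¹` of determinant-one elements fixes `v`,
so `1` is an eigenvalue of `q` and `det q = 1`, whence `(q - 1)² = 0` (Cayley–Hamilton) and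
`q^p = 1`; as `p ∤ |G|`, `q = 1`. [folklore] -/
theorem mul_comm_of_det_eq_one (hp : ¬ p ∣ Nat.card G)
    {B : Type*} [Field B] (f : ZMod p →+* B) {v : Fin 2 → B} (hv : v ≠ 0)
    (hB : ∀ g ∈ G, GeneralLinearGroup.det g = 1 → ∃ a : B, ((g : Matrix (Fin 2) (Fin 2) (ZMod p)).map f) *ᵥ v = a • v)
    {a b : GL (Fin 2) (ZMod p)} (ha : a ∈ G) (hb : b ∈ G)
    (ha1 : GeneralLinearGroup.det a = 1) (hb1 : GeneralLinearGroup.det b = 1) :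
    a * b = b * a := by
  haveI : Finite G := Nat.finite_of_card_ne_zero (fun h ↦ hp (h ▸ dvd_zero p))
  set q : GL (Fin 2) (ZMod p) := a * b * a⁻¹ * b⁻¹ with hq
  have hqG : q ∈ G := G.mul_mem (G.mul_mem (G.mul_mem ha hb) (G.inv_mem ha)) (G.inv_mem hb)
  have hq1 : GeneralLinearGroup.det q = 1 := by
    simp only [hq, map_mul, map_inv, ha1, hb1, inv_one, mul_one]
  -- `f(q) v = v`
  obtain ⟨α, hα⟩ := hB a ha ha1
  obtain ⟨β, hβ⟩ := hB b hb hb1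
  obtain ⟨hα0, hαi⟩ := map_inv_mulVec_eq f hv hα
  obtain ⟨hβ0, hβi⟩ := map_inv_mulVec_eq f hv hβ
  have hqv : ((q : Matrix (Fin 2) (Fin 2) (ZMod p)).map f) *ᵥ v = v := by
    simp only [hq, Units.val_mul, Matrix.map_mul, ← Matrix.mulVec_mulVec, hβi, Matrix.mulVec_smul,
      hαi, hβ, hα, smul_smul]
    convert one_smul B v using 2
    field_simp
  -- hence `det (q - 1) = 0`, `tr q = 2`, `(q - 1)² = 0`
  set N : Matrix (Fin 2) (Fin 2) (ZMod p) := (q : Matrix (Fin 2) (Fin 2) (ZMod p)) - 1 with hN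
  have hdetN : N.det = 0 := by
    have h1 : (N.map f).det = 0 := by
      refine Matrix.exists_mulVec_eq_zero_iff.mp ⟨v, hv, ?_⟩
      rw [hN, Matrix.map_sub _ (map_sub f), Matrix.sub_mulVec, hqv,
        Matrix.map_one _ (map_zero f) (map_one f), Matrix.one_mulVec, sub_self]
    rw [← RingHom.mapMatrix_apply, ← RingHom.map_det, map_eq_zero] at h1
    exact h1
  have hdetq : (q : Matrix (Fin 2) (Fin 2) (ZMod p)).det = 1 := by
    have h := congrArg (fun u : (ZMod p)ˣ ↦ (u : ZMod p)) hq1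
    simpa only [GeneralLinearGroup.val_det_apply, Units.val_one] using h
  have htr : (q : Matrix (Fin 2) (Fin 2) (ZMod p)).trace = 2 := by
    have h : N = (-1 : ZMod p) • (1 : Matrix (Fin 2) (Fin 2) (ZMod p)) + (1 : ZMod p) • (q : Matrix (Fin 2) (Fin 2) (ZMod p)) := by
      rw [hN, neg_smul, one_smul, one_smul]; abel
    rw [h, DeligneSerre1974.TwoByTwo.det_smul_one_add_smul, hdetq] at hdetN
    linear_combination -hdetN
  have hNN : N * N = 0 := by
    have hCH := DeligneSerre1974.TwoByTwo.mul_self_eq (q : Matrix (Fin 2) (Fin 2) (ZMod p))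
    rw [htr, hdetq, one_smul] at hCH
    rw [hN, sub_mul, mul_sub, mul_sub, hCH, mul_one, one_mul, one_mul]
    rw [two_smul]; abel
  -- so `q ^ p = 1` and `q = 1`
  have hqp : q ^ p = 1 := by
    refine Units.ext ?_
    rw [Units.val_pow_eq_pow_val, show (q : Matrix (Fin 2) (Fin 2) (ZMod p)) = 1 + N by rw [hN]; abel,
      DeligneSerre1974.one_add_pow_of_mul_self_eq_zero hNN, ZMod.natCast_self, zero_smul,
      add_zero, Units.val_one]
  have horder : orderOf q ∣ p := orderOf_dvd_of_pow_eq_one hqp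
  rcases (Nat.dvd_prime (Fact.out : p.Prime)).mp horder with h | h
  · have hq1' : q = 1 := orderOf_eq_one_iff.mp h
    rw [hq] at hq1'
    calc a * b = a * b * a⁻¹ * b⁻¹ * (b * a) := by group
      _ = b * a := by rw [hq1', one_mul]
  · exfalso
    apply hp
    have hdvd : orderOf q ∣ Nat.card G := by
      rw [← Subgroup.orderOf_mk q hqG]
      exact orderOf_dvd_natCard _
    exact (dvd_of_eq h.symm).trans hdvd


/-! ### Squares in `𝔽_pˣ` -/

/-- In `𝔽_p` (`p ≠ 2`) the product of two non-squares is a square (the quadratic character is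
multiplicative). [folklore] -/
theorem isSquare_mul_of_not_isSquare {a b : ZMod p} (ha : ¬ IsSquare a) (hb : ¬ IsSquare b) :
    IsSquare (a * b) := by
  have ha0 : a ≠ 0 := by rintro rfl; exact ha IsSquare.zero
  have hb0 : b ≠ 0 := by rintro rfl; exact hb IsSquare.zero
  rw [← quadraticChar_neg_one_iff_not_isSquare] at ha hb
  rw [← quadraticChar_one_iff_isSquare (mul_ne_zero ha0 hb0), map_mul, ha, hb]
  norm_num

/-! ### The Cartan subgroup `𝔽_p[g₀]ˣ` and its normaliser -/

/-- **Freitas–Le Hung–Siksek 2015, Lemma 3.2 (with oddness; Dickson-free form).** Let `p ≠ 2`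
and let `G ≤ GL₂(𝔽_p)` be irreducible (no `G`-stable line in `𝔽_p²`), such that the elements of
`G` of determinant `1` have a common eigenvector after some base change `f : 𝔽_p → B`
("`G ∩ SL₂(𝔽_p)` is absolutely reducible"), containing an involution `c` of determinant `-1`
("`G` odd") and with `det(G) = 𝔽_pˣ`. Then there is a non-scalar regular semisimple `g₀ ∈ G` of
determinant `1` such that, for the Cartan subgroup `C = 𝔽_p[g₀]ˣ`
(`Serre1972.unitGroup_adjoinElem_mem_cartanSubgroups`): `G` normalises `C`, and
`G ∩ C = {g ∈ G | det g ∈ (𝔽_pˣ)²}` ("`G` is contained in the normalizer of a Cartan subgroup …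
`G ∩ GL₂⁺(𝔽_p)` is contained in a Cartan subgroup"). Proof: `p ∤ |G|`
(`not_dvd_card_of_irreducible_of_eigenvector`); a non-scalar `g₀ ∈ G ∩ SL₂` exists
(`exists_det_eq_one_ne_smul_one`) and is regular (`disc_ne_zero_of_not_dvd_card`); `G ∩ SL₂` is
abelian (`mul_comm_of_det_eq_one`), so lies in `𝔽_p[g₀]ˣ`, and is the kernel of `det` on `G`,
whence `G` normalises `𝔽_p[g₀]` (`Serre1972.le_normalizer_unitGroup_adjoinElem`); `G ⊄ C`
(irreducibility in the split case, `c² = 1 ≠ ±c` in the field `𝔽_p[g₀]` in the non-split case),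
and as squares of elements of `N(C)` lie in `C` (`Serre1972.sq_eq_smul_one_of_mem_normalizer`) and
`det` is onto, `g ∈ C ⟺ det g` is a square. The source argues instead with Dickson's list of
subgroups of `PGL₂(𝔽_p)` (Swinnerton-Dyer); oddness, available in its only application
(Prop. 1.1), replaces it. [cite: FreitasLeHungSiksek2015, Lemma 3.2] -/
theorem exists_le_normalizer_unitGroup_adjoinElem (hp2 : p ≠ 2)
    (hirr : ∀ v : Fin 2 → ZMod p, v ≠ 0 → ∃ g ∈ G, ∀ a : ZMod p, (g : Matrix (Fin 2) (Fin 2) (ZMod p)) *ᵥ v ≠ a • v)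
    {B : Type*} [Field B] (f : ZMod p →+* B) {v : Fin 2 → B} (hv : v ≠ 0)
    (hB : ∀ g ∈ G, GeneralLinearGroup.det g = 1 → ∃ a : B, ((g : Matrix (Fin 2) (Fin 2) (ZMod p)).map f) *ᵥ v = a • v)
    {c : GL (Fin 2) (ZMod p)} (hcG : c ∈ G) (hcc : c * c = 1)
    (hcdet : GeneralLinearGroup.det c = -1)
    (hdet : ∀ u : (ZMod p)ˣ, ∃ g ∈ G, GeneralLinearGroup.det g = u) :
    ∃ g₀ ∈ G, GeneralLinearGroup.det g₀ = 1 ∧ (∀ s : ZMod p, (g₀ : Matrix (Fin 2) (Fin 2) (ZMod p)) ≠ s • 1) ∧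
      (g₀ : Matrix (Fin 2) (Fin 2) (ZMod p)).trace ^ 2 - 4 * (g₀ : Matrix (Fin 2) (Fin 2) (ZMod p)).det ≠ 0 ∧
      G ≤ Subgroup.normalizer
        (Serre1972.unitGroup (Serre1972.adjoinElem (g₀ : Matrix (Fin 2) (Fin 2) (ZMod p))) : Set (GL (Fin 2) (ZMod p))) ∧
      ∀ g ∈ G, g ∈ Serre1972.unitGroup (Serre1972.adjoinElem (g₀ : Matrix (Fin 2) (Fin 2) (ZMod p))) ↔
        IsSquare (g : Matrix (Fin 2) (Fin 2) (ZMod p)).det := by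
  have hp := not_dvd_card_of_irreducible_of_eigenvector hirr f hv hB
  obtain ⟨g₀, hg₀G, hg₀1, hg₀s⟩ := exists_det_eq_one_ne_smul_one hp2 hirr hcG hcc hcdet
  have hdisc := disc_ne_zero_of_not_dvd_card hp2 hp hg₀G hg₀s
  have hCartan := Serre1972.unitGroup_adjoinElem_mem_cartanSubgroups hg₀s hdisc
  set C := Serre1972.unitGroup (Serre1972.adjoinElem (g₀ : Matrix (Fin 2) (Fin 2) (ZMod p))) with hC
  refine ⟨g₀, hg₀G, hg₀1, hg₀s, hdisc, ?_⟩
  -- (5) determinant-one elements of `G` commute with `g₀`, hence lie in `𝔽_p[g₀]`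
  have h5 : ∀ g ∈ G, GeneralLinearGroup.det g = 1 → g ∈ C := by
    intro g hg hg1
    have hcomm := mul_comm_of_det_eq_one hp f hv hB hg₀G hg hg₀1 hg1
    have hmat : (g₀ : Matrix (Fin 2) (Fin 2) (ZMod p)) * (g : Matrix (Fin 2) (Fin 2) (ZMod p)) = (g : Matrix (Fin 2) (Fin 2) (ZMod p)) * (g₀ : Matrix (Fin 2) (Fin 2) (ZMod p)) := by
      rw [← Units.val_mul, hcomm, Units.val_mul]
    obtain ⟨a, b, hab⟩ :=
      DeligneSerre1974.TwoByTwo.exists_eq_smul_one_add_smul_of_commute hg₀s hmat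
    exact ⟨a, b, hab⟩
  -- (6) `G` normalises `C`
  have h6 : G ≤ Subgroup.normalizer (C : Set (GL (Fin 2) (ZMod p))) := by
    refine Serre1972.le_normalizer_unitGroup_adjoinElem (x := (⟨g₀, hg₀G⟩ : G)) hg₀s ?_
    set fd : G →* (ZMod p)ˣ := (GeneralLinearGroup.det).comp G.subtype with hfd
    have hker : fd.ker ≤ Subgroup.centralizer ({(⟨g₀, hg₀G⟩ : G)} : Set G) := by
      intro x hx
      rw [MonoidHom.mem_ker] at hx
      rw [Subgroup.mem_centralizer_singleton_iff]
      exact Subtype.ext (mul_comm_of_det_eq_one hp f hv hB x.2 hg₀G hx hg₀1)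
    rw [← Subgroup.comap_map_eq_self hker]
    exact Subgroup.Normal.comap inferInstance fd
  -- (7a) `G ⊄ C`
  have h7a : ¬ G ≤ C := by
    intro hle
    rcases hCartan with ⟨P, hP⟩ | ⟨k, hk, -, hkC⟩
    · obtain ⟨g, hg, hne⟩ := hirr ((P : Matrix (Fin 2) (Fin 2) (ZMod p)).col 0) (col_ne_zero P 0)
      obtain ⟨⟨a, ha⟩, -⟩ := Serre1972.mem_splitCartan_iff_col.mp (hP ▸ hle hg)
      exact hne a ha
    · have hck : (c : Matrix (Fin 2) (Fin 2) (ZMod p)) ∈ k := by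
        have h := hle hcG
        rw [hkC] at h
        exact h
      have hcc' : (c : Matrix (Fin 2) (Fin 2) (ZMod p)) * (c : Matrix (Fin 2) (Fin 2) (ZMod p)) = 1 := by rw [← Units.val_mul, hcc, Units.val_one]
      -- `(c - 1)(c + 1) = 0` in the field `k`, but `c ≠ ±1`
      have hx : (⟨(c : Matrix (Fin 2) (Fin 2) (ZMod p)) - 1, k.sub_mem hck k.one_mem⟩ : k) ≠ 0 := by
        intro h
        apply ne_smul_one_of_mul_self_eq_one hp2 hcc hcdet 1
        rw [one_smul]
        exact sub_eq_zero.mp (congrArg Subtype.val h)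
      obtain ⟨z, hz⟩ := hk.mul_inv_cancel hx
      have hy : (⟨(c : Matrix (Fin 2) (Fin 2) (ZMod p)) + 1, k.add_mem hck k.one_mem⟩ : k) = 0 := by
        have hxy : (⟨(c : Matrix (Fin 2) (Fin 2) (ZMod p)) + 1, k.add_mem hck k.one_mem⟩ : k) *
            ⟨(c : Matrix (Fin 2) (Fin 2) (ZMod p)) - 1, k.sub_mem hck k.one_mem⟩ = 0 := by
          apply Subtype.ext
          change ((c : Matrix (Fin 2) (Fin 2) (ZMod p)) + 1) * ((c : Matrix (Fin 2) (Fin 2) (ZMod p)) - 1) = 0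
          rw [add_mul, mul_sub, mul_sub, hcc', one_mul, mul_one, one_mul]; abel
        calc (⟨(c : Matrix (Fin 2) (Fin 2) (ZMod p)) + 1, k.add_mem hck k.one_mem⟩ : k)
            = ⟨(c : Matrix (Fin 2) (Fin 2) (ZMod p)) + 1, k.add_mem hck k.one_mem⟩ *
                (⟨(c : Matrix (Fin 2) (Fin 2) (ZMod p)) - 1, k.sub_mem hck k.one_mem⟩ * z) := by rw [hz, mul_one]
          _ = 0 := by rw [← mul_assoc, hxy, zero_mul]
      apply ne_smul_one_of_mul_self_eq_one hp2 hcc hcdet (-1)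
      rw [neg_smul, one_smul]
      exact eq_neg_of_add_eq_zero_left (congrArg Subtype.val hy)
  -- squares of elements of `G` lie in `C`
  have hsq : ∀ x ∈ G, x * x ∈ C := by
    intro x hx
    by_cases hxC : x ∈ C
    · exact C.mul_mem hxC hxC
    · obtain ⟨s, hs⟩ :=
        Serre1972.sq_eq_smul_one_of_mem_normalizer hCartan (fun _ ↦ hp2) (h6 hx) hxC
      exact Serre1972.mem_of_coe_eq_smul_one hCartan (by rw [← sq]; exact hs)
  -- (7b) `det g` square ⇒ `g ∈ C`
  have h7b : ∀ g ∈ G, IsSquare (g : Matrix (Fin 2) (Fin 2) (ZMod p)).det → g ∈ C := by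
    rintro g hg ⟨r, hr⟩
    have hr0 : r ≠ 0 := by
      rintro rfl
      exact GL2.det_ne_zero g (by rw [hr, mul_zero])
    obtain ⟨h, hhG, hh⟩ := hdet (Units.mk0 r hr0)
    have h1 : GeneralLinearGroup.det (g * (h * h)⁻¹) = 1 := by
      rw [map_mul, map_inv, map_mul, hh]
      refine Units.ext ?_
      simp only [Units.val_mul, Units.val_inv_eq_inv_val, Units.val_mk0, Units.val_one,
        GeneralLinearGroup.val_det_apply, hr]
      field_simp
    have hmem := C.mul_mem (h5 _ (G.mul_mem hg (G.inv_mem (G.mul_mem hhG hhG))) h1) (hsq h hhG)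
    rwa [inv_mul_cancel_right] at hmem
  refine ⟨h6, fun g hg ↦ ⟨fun hgC ↦ ?_, h7b g hg⟩⟩
  -- (7c) `g ∈ C` ⇒ `det g` square
  by_contra hns
  apply h7a
  intro x hx
  by_cases hxs : IsSquare (x : Matrix (Fin 2) (Fin 2) (ZMod p)).det
  · exact h7b x hx hxs
  · have hsq' : IsSquare ((x * g⁻¹ : GL (Fin 2) (ZMod p)) : Matrix (Fin 2) (Fin 2) (ZMod p)).det := by
      rw [Units.val_mul, Matrix.det_mul, Matrix.coe_units_inv, Matrix.det_nonsing_inv,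
        Ring.inverse_eq_inv']
      exact isSquare_mul_of_not_isSquare hxs (by rwa [isSquare_inv])
    have hxg := h7b _ (G.mul_mem hx (G.inv_mem hg)) hsq'
    have := C.mul_mem hxg hgC
    rwa [inv_mul_cancel_right] at this

end Subgroup

end Literature.NumberTheory.GaloisRepresentations.FLS2015
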